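import Mathlib
import Summits.NavierStokesRegularity.NavierStokesRegularity.Theorems.ThreadingFluxCentreJetDefs
import Summits.NavierStokesRegularity.NavierStokesRegularity.Theorems.ThreadingFluxCentreJetTriaxialRigidityEvolution
import HarnessLib

/-!
# Crux `PoloidalLiouville` (stmt-NavierStokesRegularity-1222, wall W1), crux idea «steady-centre-sieve» (ns-idea-15):
# «EVOLUTION L1» BY NAME

Support file (`--supports stmt-NavierStokesRegularity-1222`, helper; cell `ns-wall-extremal`, width hand ns-wall-eng-7 g7, 0 kit).
The typed Prop `CentreJet.TriaxialToroidalJetRigidityEvolution` (Defs twin append v7) is closed BY NAME by the kernel theorem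
`CentreJet.triaxialToroidalJetRigidity_evolution` (`ThreadingFluxCentreJetTriaxialRigidityEvolution.lean`), whose statement is the Prop
body verbatim.  HONEST FRAME: information-grade helper on the structure of the CentreJet line; `PoloidalLiouville` (1222) and NS
regularity OPEN; C1/C1*/C1″ untouched; movement on the wall: 0.
-/

-- the summit and its single sub-problem share the name (CONVENTIONS §1)
set_option linter.dupNamespace false

namespace Summit.NavierStokesRegularity.NavierStokesRegularity.Theorems.PoloidalLiouville.CentreJet

/-- ★ **«EVOLUTION L1» holds** (kernel, by name): `TriaxialToroidalJetRigidityEvolution`. -/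
theorem triaxialToroidalJetRigidityEvolution : TriaxialToroidalJetRigidityEvolution :=
  triaxialToroidalJetRigidity_evolution

end Summit.NavierStokesRegularity.NavierStokesRegularity.Theorems.PoloidalLiouville.CentreJet
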